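import Summits.ValiantsHypothesis.ValiantsHypothesis.Theorems.LacunarySymmetroidMatrixDescartesCensusEndKill
import Summits.ValiantsHypothesis.ValiantsHypothesis.Theorems.LacunarySymmetroidMatrixDescartesCensusTwistedRolle

/-!
# `MatrixDescartes` census — twisted Rolle and END-KILL with positive roots counted WITH MULTIPLICITY

HONEST FRAMING.  Object-search cell `pub-symmetroid`, route crux `Theses.LacunarySymmetroid.MatrixDescartes`
(ledger item stmt-ValiantsHypothesis-18050).  Elementary real-root tools about ONE real polynomial, in the
currency `#Z₊^{mult}(f) = f.roots.countP (0 < ·)` (positive roots counted with multiplicity — the currency of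
Mathlib's Descartes rule `Polynomial.roots_countP_pos_le_signVariations`), refining the tree's distinct-root tools
(`card_posRoots_le_card_posRoots_twist_succ`, `…_twist_of_endKill`):

* a COUNTING LEMMA in the pattern of Mathlib's `Polynomial.card_roots_le_derivative`: an interleaved set of
  positive roots of `G` avoiding the roots of `p`, plus `rootMultiplicity x p ≤ rootMultiplicity x G + 1` at the
  positive roots of `p`, bound `#Z₊^{mult}(p)` by `#Z₊^{mult}(G)` (`countP_posRoots_add_le_of_interleaved`);
* TWISTED ROLLE with multiplicity: `#Z₊^{mult}(f) ≤ #Z₊^{mult}(X·f′ − E·f) + 1`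
  (`countP_posRoots_le_countP_posRoots_twist_succ`);
* END-KILL with multiplicity: if the two LOWEST coefficients of `f` have the same sign then the Euler twist at the
  lowest exponent loses no positive root, multiplicities included
  (`countP_posRoots_le_countP_posRoots_derivative_of_endKill`, `…_twist_of_endKill`).

These are the tools for THEOREM N″ (the window lemma `newton_window_of_alternating` with multiplicity, companion
file `…CensusWindowNMult.lean`), whose corollary is engine-3 g15's ONE-SLACK NEWTON LEMMA (V = 19 layer).
Nothing here bears on `ζ_sym`, `DoorA26`/`DoorA34`, the crux, or `VP ≠ VNP`.

[folklore] Rolle with multiplicity; no single source.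
-/

-- `Summit.ValiantsHypothesis.ValiantsHypothesis.…` repeats a component by the D-0017 layout
-- (single-conjunct summit), which the `dupNamespace` linter flags; the name is mandated.
set_option linter.dupNamespace false

namespace Summit.ValiantsHypothesis.ValiantsHypothesis.Theorems.LacunarySymmetroidMatrixDescartes.Census

open Polynomial Finset Set
open scoped BigOperators Polynomial

/-! ### Counting with multiplicity -/

/-- `#Z₊^{mult}(p)` as a sum of root multiplicities over the distinct positive roots. [folklore] -/
theorem countP_posRoots_eq_sum_rootMultiplicity (p : ℝ[X]) :
    p.roots.countP (fun x => 0 < x) =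
      ∑ x ∈ p.roots.toFinset.filter (fun x => 0 < x), p.rootMultiplicity x := by
  classical
  rw [Multiset.countP_eq_card_filter, ← Multiset.toFinset_sum_count_eq, Multiset.toFinset_filter]
  refine Finset.sum_congr rfl fun x hx => ?_
  rw [Finset.mem_filter] at hx
  rw [Multiset.count_filter_of_pos hx.2, count_roots]

/-- **Counting lemma** (Mathlib's `card_roots_le_derivative` pattern, localised to positive roots and to an
arbitrary comparison polynomial `G ≠ 0`).  If every positive root `x` of `p` satisfies
`rootMultiplicity x p ≤ rootMultiplicity x G + 1`, and the distinct positive roots of `p`, `extra` more of them,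
are interleaved by positive roots of `G` that are NOT roots of `p`
(`#Z₊(p) + extra ≤ #(Z₊(G) ∖ Z₊(p)) + 1`), then `#Z₊^{mult}(p) + extra ≤ #Z₊^{mult}(G) + 1`. [folklore] -/
theorem countP_posRoots_add_le_of_interleaved (p G : ℝ[X]) (hG : G ≠ 0) (extra : ℕ)
    (hmult : ∀ x ∈ p.roots.toFinset.filter (fun x => 0 < x), p.rootMultiplicity x ≤ G.rootMultiplicity x + 1)
    (hinter : (p.roots.toFinset.filter (fun x => 0 < x)).card + extra ≤
      ((G.roots.toFinset.filter (fun x => 0 < x)) \ (p.roots.toFinset.filter (fun x => 0 < x))).card + 1) :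
    p.roots.countP (fun x => 0 < x) + extra ≤ G.roots.countP (fun x => 0 < x) + 1 := by
  classical
  set s := p.roots.toFinset.filter (fun x => 0 < x) with hs
  set t := G.roots.toFinset.filter (fun x => 0 < x) with ht
  set u := t \ s with hu
  have hdisj : Disjoint s u := Finset.disjoint_sdiff
  have hsub : s ∪ u ⊆ s ∪ t := Finset.union_subset_union (le_refl s) Finset.sdiff_subset
  -- multiplicities of `G` at points of `u` are at least `1`
  have hu1 : ∀ x ∈ u, 1 ≤ G.rootMultiplicity x := by
    intro x hx
    rw [hu, Finset.mem_sdiff, ht, Finset.mem_filter, Multiset.mem_toFinset, mem_roots hG] at hx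
    exact Nat.succ_le_of_lt ((rootMultiplicity_pos hG).mpr hx.1.1)
  -- terms outside `t` vanish
  have hzero : ∀ x ∈ s ∪ t, x ∉ t → G.rootMultiplicity x = 0 := by
    intro x hx hxt
    rw [rootMultiplicity_eq_zero_iff]
    intro hroot
    exfalso; apply hxt
    rw [ht, Finset.mem_filter, Multiset.mem_toFinset, mem_roots hG]
    refine ⟨hroot, ?_⟩
    rcases Finset.mem_union.mp hx with h | h
    · exact (Finset.mem_filter.mp h).2
    · exact (Finset.mem_filter.mp h).2
  calc p.roots.countP (fun x => 0 < x) + extra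
      = (∑ x ∈ s, p.rootMultiplicity x) + extra := by rw [countP_posRoots_eq_sum_rootMultiplicity]
    _ ≤ (∑ x ∈ s, (G.rootMultiplicity x + 1)) + extra := by
        gcongr with x hx
        exact hmult x hx
    _ = (∑ x ∈ s, G.rootMultiplicity x) + (s.card + extra) := by
        rw [Finset.sum_add_distrib, Finset.card_eq_sum_ones]; ring
    _ ≤ (∑ x ∈ s, G.rootMultiplicity x) + (u.card + 1) := by gcongr
    _ = (∑ x ∈ s, G.rootMultiplicity x) + (∑ x ∈ u, 1) + 1 := by
        rw [Finset.card_eq_sum_ones]; ring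
    _ ≤ (∑ x ∈ s, G.rootMultiplicity x) + (∑ x ∈ u, G.rootMultiplicity x) + 1 := by
        gcongr with x hx
        exact hu1 x hx
    _ = (∑ x ∈ s ∪ u, G.rootMultiplicity x) + 1 := by rw [Finset.sum_union hdisj]
    _ ≤ (∑ x ∈ s ∪ t, G.rootMultiplicity x) + 1 := by
        gcongr 1
        exact Finset.sum_le_sum_of_subset hsub
    _ = (∑ x ∈ t, G.rootMultiplicity x) + 1 := by
        rw [← Finset.sum_subset Finset.subset_union_right hzero]
    _ = G.roots.countP (fun x => 0 < x) + 1 := by rw [countP_posRoots_eq_sum_rootMultiplicity]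

/-- A root of multiplicity `m` of `f` is a root of multiplicity at least `m − 1` of every Euler twist
`X·f′ − E·f`. [folklore] -/
theorem rootMultiplicity_le_rootMultiplicity_twist_succ (f : ℝ[X]) (E x : ℝ)
    (hg : X * derivative f - C E * f ≠ 0) :
    f.rootMultiplicity x ≤ (X * derivative f - C E * f).rootMultiplicity x + 1 := by
  have h1 : (X - C x) ^ (f.rootMultiplicity x - 1) ∣ derivative f := by
    rcases eq_or_ne (derivative f) 0 with hd | hd
    · rw [hd]; exact dvd_zero _
    · exact (le_rootMultiplicity_iff hd).mp (rootMultiplicity_sub_one_le_derivative_rootMultiplicity f x)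
  have h2 : (X - C x) ^ (f.rootMultiplicity x - 1) ∣ f :=
    (pow_dvd_pow _ (Nat.sub_le _ _)).trans (pow_rootMultiplicity_dvd f x)
  have h3 : (X - C x) ^ (f.rootMultiplicity x - 1) ∣ X * derivative f - C E * f :=
    dvd_sub (dvd_mul_of_dvd_right h1 _) (dvd_mul_of_dvd_right h2 _)
  have := (le_rootMultiplicity_iff hg).mpr h3
  omega

/-- Positive roots, with multiplicity, are unchanged by a monomial factor `X^k`. [folklore] -/
theorem countP_posRoots_X_pow_mul (p : ℝ[X]) (k : ℕ) :
    ((X ^ k * p).roots.countP (fun x => 0 < x)) = p.roots.countP (fun x => 0 < x) := by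
  rcases eq_or_ne p 0 with rfl | hp
  · simp
  have hne : (X : ℝ[X]) ^ k * p ≠ 0 := mul_ne_zero (pow_ne_zero _ X_ne_zero) hp
  rw [roots_mul hne, Multiset.countP_add, roots_X_pow]
  have : Multiset.countP (fun x : ℝ => 0 < x) (k • ({0} : Multiset ℝ)) = 0 := by
    rw [Multiset.countP_eq_zero]
    intro x hx
    rw [Multiset.mem_nsmul] at hx
    rw [Multiset.mem_singleton.mp hx.2]
    exact lt_irrefl 0
  rw [this, zero_add]

/-- Positive roots, with multiplicity, are unchanged by negation. [folklore] -/
theorem countP_posRoots_neg (p : ℝ[X]) :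
    (-p).roots.countP (fun x => 0 < x) = p.roots.countP (fun x => 0 < x) := by
  rw [roots_neg]

/-! ### Twisted Rolle with multiplicity -/

/-- **Twisted Rolle, with multiplicity.**  For a real polynomial `f` and a real weight `E`, the Euler twist
`X·f′ − E·f` has at least as many positive roots COUNTED WITH MULTIPLICITY as `f`, less one:
`#Z₊^{mult}(f) ≤ #Z₊^{mult}(X f′ − E f) + 1`.  (Rolle for `u ↦ f(u)·u^(−E)` between consecutive positive roots
gives twist roots off the roots of `f`; a root of `f` of multiplicity `m` is a twist root of multiplicity `≥ m − 1`;
when the twist vanishes identically `f` is a monomial and has no positive root.) [folklore] -/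
theorem countP_posRoots_le_countP_posRoots_twist_succ (f : ℝ[X]) (E : ℝ) :
    f.roots.countP (fun x => 0 < x) ≤
      (X * derivative f - C E * f).roots.countP (fun x => 0 < x) + 1 := by
  classical
  rcases eq_or_ne f 0 with rfl | hf
  · simp
  rcases eq_or_ne (X * derivative f - C E * f) 0 with hg | hg
  · -- the twist vanishes: `f = c · X ^ natDegree f`, no positive root
    have hcoef : ∀ n, n ≠ f.natDegree → f.coeff n = 0 := by
      intro n hn
      have h1 := coeff_X_mul_derivative_sub_C_mul f E n
      have h2 := coeff_X_mul_derivative_sub_C_mul f E f.natDegree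
      rw [hg, coeff_zero] at h1 h2
      have hlead : f.coeff f.natDegree ≠ 0 := by
        rw [coeff_natDegree]; exact leadingCoeff_ne_zero.mpr hf
      have hE : (f.natDegree : ℝ) - E = 0 := by
        rcases mul_eq_zero.mp h2.symm with h | h
        · exact h
        · exact absurd h hlead
      rcases mul_eq_zero.mp h1.symm with h | h
      · exfalso; apply hn
        have : (n : ℝ) = f.natDegree := by linarith
        exact_mod_cast this
      · exact h
    have hnone : f.roots.countP (fun x => 0 < x) = 0 := by
      rw [Multiset.countP_eq_zero]
      intro x hx hxpos
      rw [mem_roots hf, IsRoot.def, eval_eq_sum_range, Finset.sum_eq_single f.natDegree] at hx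
      · rcases mul_eq_zero.mp hx with h | h
        · exact (leadingCoeff_ne_zero.mpr hf) (by rwa [coeff_natDegree] at h)
        · exact absurd h (pow_ne_zero _ hxpos.ne')
      · intro n _ hn; rw [hcoef n hn, zero_mul]
      · intro h; exact absurd (Finset.mem_range.mpr (Nat.lt_succ_self _)) h
    rw [hnone]; exact Nat.zero_le _
  suffices hinter : (f.roots.toFinset.filter (fun x => 0 < x)).card ≤
      (((X * derivative f - C E * f).roots.toFinset.filter (fun x => 0 < x)) \
        (f.roots.toFinset.filter (fun x => 0 < x))).card + 1 by
    have key := countP_posRoots_add_le_of_interleaved f (X * derivative f - C E * f) hg 0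
      (fun x _ => rootMultiplicity_le_rootMultiplicity_twist_succ f E x hg) (by rw [add_zero]; exact hinter)
    rw [add_zero] at key
    exact key
  refine Finset.card_le_sdiff_of_interleaved fun x hx y hy hxy _ => ?_
  simp only [Finset.mem_filter, Multiset.mem_toFinset, mem_roots hf, IsRoot.def] at hx hy
  obtain ⟨hfx, hx0⟩ := hx
  obtain ⟨hfy, hy0⟩ := hy
  -- Rolle for `h u = f(u) · exp (−E · log u)` on `[x, y] ⊂ (0, ∞)`
  have hder : ∀ u ∈ Set.Ioo x y, HasDerivAt (fun u => f.eval u * Real.exp (-E * Real.log u))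
      ((derivative f).eval u * Real.exp (-E * Real.log u) +
        f.eval u * (Real.exp (-E * Real.log u) * (-E * u⁻¹))) u := by
    intro u hu
    have hu0 : u ≠ 0 := (hx0.trans hu.1).ne'
    refine (f.hasDerivAt u).mul ?_
    exact ((Real.hasDerivAt_log hu0).const_mul (-E)).exp
  have hcont : ContinuousOn (fun u => f.eval u * Real.exp (-E * Real.log u)) (Set.Icc x y) := by
    refine f.continuousOn.mul (Real.continuous_exp.comp_continuousOn
      ((continuousOn_const.mul (Real.continuousOn_log.mono ?_))))
    intro u hu; exact (hx0.trans_le hu.1).ne'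
  obtain ⟨z, hz, hz0⟩ := exists_hasDerivAt_eq_zero hxy hcont (by simp [hfx, hfy]) hder
  have hz0' : 0 < z := hx0.trans hz.1
  refine ⟨z, ?_, hz.1, hz.2⟩
  simp only [Finset.mem_filter, Multiset.mem_toFinset, mem_roots hg, IsRoot.def, eval_sub, eval_mul, eval_X,
    eval_C]
  refine ⟨?_, hz0'⟩
  have hexp : 0 < Real.exp (-E * Real.log z) := Real.exp_pos _
  have key : Real.exp (-E * Real.log z) * (z * (derivative f).eval z - E * f.eval z)
      = ((derivative f).eval z * Real.exp (-E * Real.log z) +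
          f.eval z * (Real.exp (-E * Real.log z) * (-E * z⁻¹))) * z := by
    field_simp
    ring
  rw [hz0, zero_mul] at key
  rcases mul_eq_zero.mp key with h | h
  · exact absurd h hexp.ne'
  · linarith [h]

/-! ### END-KILL with multiplicity -/

/-- **END-KILL LEMMA, with multiplicity (positive normalisation).**  `h.coeff 0 > 0`, `h.coeff j = 0` for
`0 < j < m`, `h.coeff m > 0` (`m ≥ 1`) ⇒ `#Z₊^{mult}(h) ≤ #Z₊^{mult}(h′)`: besides the Rolle roots and the
multiplicity transfer, `h′` has a root in `(0, x₁)` below the smallest positive root `x₁` of `h`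
(`h` leaves `h(0) > 0` increasing and must come back to `0`). [folklore] -/
theorem countP_posRoots_le_countP_posRoots_derivative_of_endKill_pos (h : ℝ[X]) {m : ℕ} (hm : 1 ≤ m)
    (h0 : 0 < h.coeff 0) (hgap : ∀ j, 1 ≤ j → j < m → h.coeff j = 0) (hcm : 0 < h.coeff m) :
    h.roots.countP (fun x => 0 < x) ≤ h.derivative.roots.countP (fun x => 0 < x) := by
  classical
  have hne : h ≠ 0 := by intro h0'; rw [h0', coeff_zero] at h0; exact lt_irrefl 0 h0
  -- `h′` has vanishing coefficients below `m − 1` and `(h′).coeff (m−1) = m · h.coeff m > 0`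
  have hd_low : ∀ j, j < m - 1 → h.derivative.coeff j = 0 := by
    intro j hj
    rw [coeff_derivative, hgap (j + 1) (by omega) (by omega), zero_mul]
  have hd_m : 0 < h.derivative.coeff (m - 1) := by
    rw [coeff_derivative, show m - 1 + 1 = m by omega]
    have : (0 : ℝ) < (m - 1 : ℕ) + 1 := by positivity
    exact mul_pos hcm this
  have hdne : h.derivative ≠ 0 := by
    intro h0'; rw [h0', coeff_zero] at hd_m; exact lt_irrefl 0 hd_m
  obtain ⟨ε, hε, hpos⟩ := eventually_pos_of_coeff_pos h.derivative (m - 1) hd_low hd_m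
  set s := h.roots.toFinset.filter (fun x => 0 < x) with hs
  set t := h.derivative.roots.toFinset.filter (fun x => 0 < x) with ht
  have hmem_s : ∀ x, x ∈ s ↔ h.IsRoot x ∧ 0 < x := by
    intro x; rw [hs, Finset.mem_filter, Multiset.mem_toFinset, mem_roots hne]
  have hmem_t : ∀ x, x ∈ t ↔ h.derivative.IsRoot x ∧ 0 < x := by
    intro x; rw [ht, Finset.mem_filter, Multiset.mem_toFinset, mem_roots hdne]
  have h0s : (0 : ℝ) ∉ s := by rw [hmem_s]; exact fun hh => lt_irrefl 0 hh.2
  -- interleave `insert 0 s` with `t`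
  have key : (insert (0 : ℝ) s).card ≤ (t \ insert (0 : ℝ) s).card + 1 := by
    refine Finset.card_le_sdiff_of_interleaved fun x hx y hy hxy _ => ?_
    rw [Finset.mem_insert] at hx hy
    have hyroot : h.IsRoot y ∧ 0 < y := by
      rcases hy with rfl | hy
      · rcases hx with rfl | hx
        · exact absurd hxy (lt_irrefl _)
        · exact absurd ((hmem_s x).mp hx).2 (by linarith)
      · exact (hmem_s y).mp hy
    rcases hx with rfl | hx
    · -- the END KILL: a root of `h′` in `(0, y)`
      have hy0 : (0 : ℝ) < y := hyroot.2
      obtain ⟨ξ, hξ, hξslope⟩ := exists_deriv_eq_slope (fun x => h.eval x) hy0 h.continuousOn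
        (h.differentiable.differentiableOn)
      have hξneg : h.derivative.eval ξ < 0 := by
        rw [← Polynomial.deriv, hξslope, sub_zero]
        have hhy : h.eval y = 0 := hyroot.1
        have hh0 : h.eval 0 = h.coeff 0 := by rw [coeff_zero_eq_eval_zero]
        rw [hhy, hh0]
        exact div_neg_of_neg_of_pos (by linarith) hy0
      set x₀ : ℝ := min (ε / 2) (ξ / 2) with hx₀
      have hx₀pos : 0 < x₀ := lt_min (by linarith) (by linarith [hξ.1])
      have hx₀ε : x₀ < ε := lt_of_le_of_lt (min_le_left _ _) (by linarith)
      have hx₀ξ : x₀ < ξ := lt_of_le_of_lt (min_le_right _ _) (by linarith [hξ.1])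
      have hx₀val : 0 < h.derivative.eval x₀ := hpos x₀ hx₀pos hx₀ε
      have hcont : ContinuousOn (fun x => h.derivative.eval x) (Icc x₀ ξ) := h.derivative.continuousOn
      have hmem : (0 : ℝ) ∈ Ioo (h.derivative.eval ξ) (h.derivative.eval x₀) := ⟨hξneg, hx₀val⟩
      obtain ⟨z, hz, hzval⟩ := intermediate_value_Ioo' hx₀ξ.le hcont hmem
      refine ⟨z, (hmem_t z).mpr ⟨hzval, lt_trans hx₀pos hz.1⟩, lt_trans hx₀pos hz.1, ?_⟩
      exact lt_trans hz.2 hξ.2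
    · -- ordinary Rolle between two positive roots
      have hxroot := (hmem_s x).mp hx
      obtain ⟨z, hz1, hz2⟩ := exists_deriv_eq_zero hxy h.continuousOn (hxroot.1.trans hyroot.1.symm)
      refine ⟨z, (hmem_t z).mpr ⟨?_, lt_trans hxroot.2 hz1.1⟩, hz1.1, hz1.2⟩
      rw [IsRoot, ← Polynomial.deriv]; exact hz2
  rw [Finset.card_insert_of_notMem h0s] at key
  -- `t \ insert 0 s = t \ s` (elements of `t` are positive)
  have h0t : (0 : ℝ) ∉ t := by rw [hmem_t]; exact fun hh => lt_irrefl 0 hh.2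
  have hsd : t \ insert (0 : ℝ) s = t \ s := by
    ext x
    simp only [Finset.mem_sdiff, Finset.mem_insert, not_or]
    constructor
    · rintro ⟨hxt, -, hxs⟩; exact ⟨hxt, hxs⟩
    · rintro ⟨hxt, hxs⟩; exact ⟨hxt, fun hx0 => h0t (hx0 ▸ hxt), hxs⟩
  rw [hsd] at key
  have hmult : ∀ x ∈ s, h.rootMultiplicity x ≤ h.derivative.rootMultiplicity x + 1 := by
    intro x _
    have := rootMultiplicity_sub_one_le_derivative_rootMultiplicity h x
    omega
  have := countP_posRoots_add_le_of_interleaved h h.derivative hdne 1 hmult (by rw [← hs, ← ht]; omega)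
  omega

/-- **END-KILL LEMMA, with multiplicity.**  For a real polynomial `h` and `m ≥ 1` with `h.coeff j = 0` for
`0 < j < m` and `h.coeff 0 · h.coeff m > 0`, `#Z₊^{mult}(h) ≤ #Z₊^{mult}(h′)` — Rolle's bound without the `+ 1`,
multiplicities included. [folklore] -/
theorem countP_posRoots_le_countP_posRoots_derivative_of_endKill (h : ℝ[X]) {m : ℕ} (hm : 1 ≤ m)
    (hgap : ∀ j, 1 ≤ j → j < m → h.coeff j = 0) (hsame : 0 < h.coeff 0 * h.coeff m) :
    h.roots.countP (fun x => 0 < x) ≤ h.derivative.roots.countP (fun x => 0 < x) := by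
  rcases lt_or_gt_of_ne (show h.coeff 0 ≠ 0 from fun h0 => by rw [h0, zero_mul] at hsame; exact lt_irrefl 0 hsame)
    with hneg | hposc
  · have hcm : h.coeff m < 0 := by
      by_contra hc; rw [not_lt] at hc
      have := mul_nonpos_of_nonpos_of_nonneg hneg.le hc
      linarith
    have h1 := countP_posRoots_le_countP_posRoots_derivative_of_endKill_pos (-h) hm
      (by rw [coeff_neg]; linarith) (fun j hj1 hj2 => by rw [coeff_neg, hgap j hj1 hj2, neg_zero])
      (by rw [coeff_neg]; linarith)
    rwa [roots_neg, derivative_neg, roots_neg] at h1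
  · have hcm : 0 < h.coeff m := by
      by_contra hc; rw [not_lt] at hc
      have := mul_nonpos_of_nonneg_of_nonpos hposc.le hc
      linarith
    exact countP_posRoots_le_countP_posRoots_derivative_of_endKill_pos h hm hposc hgap hcm

/-- **END-KILL LEMMA, twist form, with multiplicity.**  Let `f ∈ ℝ[X]` have lowest exponent `k`
(`f.coeff j = 0` for `j < k`), next possible exponent `k + m` (`f.coeff j = 0` for `k < j < k + m`, `m ≥ 1`) and
`f.coeff k · f.coeff (k+m) > 0` (the two LOWEST coefficients have the same sign).  Then the Euler twist at the
lowest exponent loses NO positive root, multiplicities included: `#Z₊^{mult}(f) ≤ #Z₊^{mult}(X·f′ − k·f)`.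
[folklore] -/
theorem countP_posRoots_le_countP_posRoots_twist_of_endKill (f : ℝ[X]) {k m : ℕ} (hm : 1 ≤ m)
    (hlow : ∀ j, j < k → f.coeff j = 0) (hgap : ∀ j, k < j → j < k + m → f.coeff j = 0)
    (hsame : 0 < f.coeff k * f.coeff (k + m)) :
    f.roots.countP (fun x => 0 < x) ≤
      (X * derivative f - C (k : ℝ) * f).roots.countP (fun x => 0 < x) := by
  obtain ⟨h, hf⟩ : X ^ k ∣ f := (Polynomial.X_pow_dvd_iff).mpr fun d hd => hlow d hd
  have hcoeff : ∀ j, h.coeff j = f.coeff (j + k) := by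
    intro j; rw [hf, coeff_X_pow_mul]
  -- the twist of `X^k h` at weight `k` is `X^(k+1) h′`
  have htwist : X * derivative f - C (k : ℝ) * f = X ^ (k + 1) * derivative h := by
    rw [hf, derivative_mul, derivative_X_pow, map_natCast]
    rcases k with _ | k
    · simp
    · rw [show k + 1 - 1 = k from rfl, pow_succ, pow_succ]; push_cast; ring
  rw [htwist, countP_posRoots_X_pow_mul, hf, countP_posRoots_X_pow_mul]
  refine countP_posRoots_le_countP_posRoots_derivative_of_endKill h hm (fun j hj1 hj2 => ?_) ?_
  · rw [hcoeff]; exact hgap (j + k) (by omega) (by omega)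
  · rw [hcoeff, hcoeff, zero_add, show m + k = k + m from Nat.add_comm m k]; exact hsame

/-- Positive roots, with multiplicity, are unchanged by a non-zero constant factor. [folklore] -/
theorem countP_posRoots_C_mul (p : ℝ[X]) {a : ℝ} (ha : a ≠ 0) :
    (C a * p).roots.countP (fun x => 0 < x) = p.roots.countP (fun x => 0 < x) := by
  rw [roots_C_mul _ ha]

/-- Distinct positive roots are at most positive roots counted with multiplicity:
`#Z₊^{distinct}(p) ≤ #Z₊^{mult}(p)` — so every `countP` theorem of this file implies its `toFinset` form. [folklore] -/
theorem card_posRoots_le_countP_posRoots (p : ℝ[X]) :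
    (p.roots.toFinset.filter (fun x => 0 < x)).card ≤ p.roots.countP (fun x => 0 < x) := by
  classical
  calc (p.roots.toFinset.filter (fun x => 0 < x)).card
      = (p.roots.filter (fun x => 0 < x)).toFinset.card := by rw [Multiset.toFinset_filter]
    _ ≤ (p.roots.filter (fun x => 0 < x)).card := Multiset.toFinset_card_le _
    _ = p.roots.countP (fun x => 0 < x) := (Multiset.countP_eq_card_filter _ _).symm

end Summit.ValiantsHypothesis.ValiantsHypothesis.Theorems.LacunarySymmetroidMatrixDescartes.Census
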